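import Mathlib.Analysis.SpecialFunctions.Pow.Asymptotics
import Mathlib.Analysis.Complex.Basic
import Summits.MatrixMultiplication.Statement

/-!
# MatrixMultiplication / BorderRankLowerBound — assembly (rank 1)

Route `MatrixMultiplication/BorderRankLowerBound` (the refutation line X_F): a superquadratic
rank lower bound `R(⟨n,n,n⟩) ≥ c·n^{2+δ}` (`δ, c > 0`, all `n ≥ 1`) forces every admissible
exponent to be `≥ 2 + δ`, hence `ω(ℂ) ≥ 2 + δ > 2`, refuting the summit `ω(ℂ) = 2`.
Elementary asymptotics (`n^{2+δ-β} → ∞` for `β < 2 + δ`) plus `le_csInf` with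
`admissibleExponents_nonempty`.
-/

noncomputable section

open Filter Asymptotics

namespace Literature.CplxAlg

/-- If `R(⟨n,n,n⟩) ≥ c·n^{2+δ}` for all `n ≥ 1` with `c > 0`, then every admissible exponent
over `ℂ` is at least `2 + δ`. [folklore] -/
theorem add_le_of_mem_admissibleExponents_of_superquadratic {δ c : ℝ} (hc : 0 < c)
    (h : ∀ n : ℕ, 1 ≤ n →
      c * (n : ℝ) ^ (2 + δ) ≤ (Literature.Computability.AlgebraicComplexity.tensorRank (Literature.Computability.AlgebraicComplexity.matMulTensor ℂ n n n) : ℝ))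
    {β : ℝ} (hβ : β ∈ Literature.Computability.AlgebraicComplexity.admissibleExponents ℂ) : 2 + δ ≤ β := by
  by_contra hlt
  rw [not_le] at hlt
  obtain ⟨C, hC⟩ := hβ.bound
  have hev : ∀ᶠ n : ℕ in atTop, (n : ℝ) ^ (2 + δ - β) ≤ C / c := by
    filter_upwards [hC, eventually_ge_atTop 1] with n hn hn1
    have hpos : (0 : ℝ) < n := by exact_mod_cast hn1
    rw [Real.norm_of_nonneg (Nat.cast_nonneg _),
      Real.norm_of_nonneg (Real.rpow_nonneg hpos.le _)] at hn
    have hsq : c * (n : ℝ) ^ (2 + δ) ≤ C * (n : ℝ) ^ β := (h n hn1).trans hn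
    rw [Real.rpow_sub hpos, div_le_iff₀ (Real.rpow_pos_of_pos hpos _), div_mul_eq_mul_div,
      le_div_iff₀ hc]
    linarith
  have ht : Tendsto (fun n : ℕ => (n : ℝ) ^ (2 + δ - β)) atTop atTop :=
    (tendsto_rpow_atTop (by linarith)).comp tendsto_natCast_atTop_atTop
  obtain ⟨n, hn1, hn2⟩ := (hev.and (ht.eventually_gt_atTop (C / c))).exists
  exact absurd hn1 (not_le.mpr hn2)

end Literature.CplxAlg

namespace Literature

/-- Settles `stmt-MatrixMultiplication-0653` (assembly of route BorderRankLowerBound), exact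
signature: a superquadratic rank lower bound for `⟨n,n,n⟩` over `ℂ` refutes `ω(ℂ) = 2`.
[folklore] -/
theorem not_matrixMultiplication_of_superquadratic_rank :
    (∃ δ : ℝ, 0 < δ ∧ ∃ c : ℝ, 0 < c ∧ ∀ n : ℕ, 1 ≤ n →
      c * (n : ℝ) ^ (2 + δ) ≤ (Literature.Computability.AlgebraicComplexity.tensorRank (Literature.Computability.AlgebraicComplexity.matMulTensor ℂ n n n) : ℝ)) →
    ¬ MatrixMultiplication := by
  rintro ⟨δ, hδ, c, hc, h⟩ hM
  rw [MatrixMultiplication_iff] at hM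
  have h2 : 2 + δ ≤ Literature.Computability.AlgebraicComplexity.omega ℂ :=
    le_csInf (Literature.Computability.AlgebraicComplexity.admissibleExponents_nonempty ℂ)
      fun _ hβ => CplxAlg.add_le_of_mem_admissibleExponents_of_superquadratic hc h hβ
  rw [hM] at h2
  linarith

end Literature
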